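import Literature.NumberTheory.EllipticCurves.TwoDescentKummerBridgeConverse
import Literature.NumberTheory.EllipticCurves.LocalPointsIntegersSubgroup
import Literature.NumberTheory.EllipticCurves.MordellWeilModNCard
import Literature.NumberTheory.EllipticCurves.TwoDescentSelmerBookkeeping
import Literature.NumberTheory.QuadraticForms.PadicSquareClasses
import Literature.NumberTheory.QuadraticForms.HilbertSymbolRatOdd
import Literature.NumberTheory.GaloisRepresentations.KummerRestriction
import HarnessLib

/-!
# D0≤2, parity of the genus twist, III: the local Selmer condition at `ℚ_v` has finite index `≤ #(ℚ_vˣ/ℚ_vˣ²)`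

Crux R″ `RankOneTwoTorsionResidualAtTwo` (stmt-27478), LINE 49 «full_vertex», stub D0≤2
`FullTorsionGenusSelmerLawUpToTwoAtTwo`, slice `#Q₀ = 2`, the `2`-PARITY HALF of `#Sel⁽²⁾(E₀^{(−p₀q₁q₂)}) = 8`
made UNCONDITIONAL.  In Klagsbrun–Mazur–Rubin's parity argument the localisation of the RELAXED Selmer group must be
a Lagrangian, i.e. the relaxed group must be large enough; in print this is Poitou–Tate (KMR Thm. 3.9, "`Z^⊥ = Z`").
Here the needed size comes from LOCAL COUNTS already in the tree:

* §1 `natCard_sqUnits_adicCompletion_rat` — `#(ℚ_vˣ/ℚ_vˣ²) = 4` (`v` odd) resp. `8` (`v = 2`) (Serre II §3.3; tree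
  `padic_index_squares_odd/two` transported along Mathlib's `ℚ_v ≃ ℚ_p`);
* §2 `index_selmerLocalKer_le` — the local Selmer condition `selmerLocalKer E ℚ_v 2 ≤ H¹(ℚ, E[2])` of a curve with
  rational `2`-torsion has FINITE index `≤ 4` resp. `≤ 8`: it contains the preimage of the descent image `δ(E(ℚ_v))`,
  and `#δ(E(ℚ_v)) = #E(ℚ_v)/2 = #E(ℚ_v)[2] · #(𝓞_v/2) ≥ 4 · #(𝓞_v/2)` (Milne I Lemma 3.3, tree
  `card_quotient_range_nsmul_adicCompletion`; `#E(ℚ_v)[2] ≥ 4`, tree `four_le_natCard_torsionBy_two_of_splitTwoTorsion`).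

Everything is proved; no LINE 49 statement is restated; BSD is not advanced by this file alone.

## References

* [KlagsbrunMazurRubin2013] Z. Klagsbrun, B. Mazur, K. Rubin, Ann. of Math. 178 (2013), Thm. 3.9 (proof: `Z` Lagrangian).
* [MilneADT2006] J. S. Milne, *Arithmetic Duality Theorems*, 2nd ed., I Lemma 3.3.
* [Serre1973] J.-P. Serre, *A Course in Arithmetic*, Ch. II §3.3 (Cor. to Thm. 3 and Thm. 4).
* [SilvermanAEC2009] J. H. Silverman, *The Arithmetic of Elliptic Curves*, 2nd ed., Prop. X.1.4, Prop. X.4.9.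
-/

noncomputable section

open scoped Classical

namespace Summit.BirchSwinnertonDyer.BirchSwinnertonDyer.Theorems.GenusKolyvaginAtTwo.TorsionCellD0

open WeierstrassCurve WeierstrassCurve.Affine WeierstrassCurve.Affine.Point
open Literature.NumberTheory.GaloisRepresentations Literature.NumberTheory.EllipticCurves Field
open Literature.NumberTheory.EllipticCurves.TwoDescentLocal
open Literature.NumberTheory.EllipticCurves.KramerTwoDescent
open Literature.NumberTheory.QuadraticForms
open IsDedekindDomain NumberField Rat.HeightOneSpectrum

/-! ## §1 Square classes of `ℚ_v` -/

section SquareClasses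

/-- The subgroup of squares is transported by a multiplicative isomorphism. [folklore] -/
private theorem map_range_powMonoidHom_two {G G' : Type*} [CommGroup G] [CommGroup G'] (e : G ≃* G') :
    ((powMonoidHom 2 : G →* G).range).map (e : G →* G') = (powMonoidHom 2 : G' →* G').range := by
  ext x
  constructor
  · rintro ⟨y, ⟨z, rfl⟩, rfl⟩
    exact ⟨e z, by rw [powMonoidHom_apply, powMonoidHom_apply, MonoidHom.coe_coe, map_pow]⟩
  · rintro ⟨z, rfl⟩
    refine ⟨e.symm z ^ 2, ⟨e.symm z, rfl⟩, ?_⟩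
    rw [MonoidHom.coe_coe, map_pow, MulEquiv.apply_symm_apply, powMonoidHom_apply]

/-- **`#(ℚ_vˣ/ℚ_vˣ²) = 8` at the dyadic place and `= 4` at an odd place** (Serre II §3.3, Cor. to Thm. 3 / Thm. 4),
for Mathlib's completion `v.adicCompletion ℚ` (transport of the tree's `padic_index_squares_odd/two` along
`Rat.HeightOneSpectrum.adicCompletion.padicEquiv`). [cite: Serre1973, Ch. II §3.3 Cor. to Thm 3] -/
theorem natCard_sqUnits_adicCompletion_rat (v : HeightOneSpectrum (𝓞 ℚ)) :
    Nat.card (SqUnits (v.adicCompletion ℚ)) = if natGenerator v = 2 then 8 else 4 := by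
  set p : Nat.Primes := primesEquiv (R := 𝓞 ℚ) v with hp
  haveI : Fact p.1.Prime := ⟨p.2⟩
  have hgen : (p : ℕ) = natGenerator v := rfl
  let e : (v.adicCompletion ℚ)ˣ ≃* ℚ_[p]ˣ :=
    Units.mapEquiv (adicCompletion.padicEquiv (R := 𝓞 ℚ) v).toRingEquiv.toMulEquiv
  rw [SqUnits, ← Subgroup.index_eq_card, ← Subgroup.index_map_equiv _ e, map_range_powMonoidHom_two e]
  by_cases h2 : natGenerator v = 2
  · rw [if_pos h2, padic_index_squares_two (p := p) (hgen.trans h2)]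
  · rw [if_neg h2, padic_index_squares_odd (p := p) (fun h => h2 (hgen.symm.trans h))]

end SquareClasses

/-! ## §2 The index of the local Selmer condition -/

section LocalIndex

variable (E : WeierstrassCurve ℚ) [E.IsElliptic] {e₁ e₂ e₃ : ℚ}

/-! Throughout, `CharZero ℚ_v` is passed EXPLICITLY (never as a local instance): with a `CharZero` instance in
scope the `ℚ`-algebra structure of `ℚ_v` would be inferred as `DivisionRing.toRatAlgebra` instead of the completion
algebra used by the tree's local theory (the same device as the explicit `hE : CharZero E` of
`twoDescentClass_quadraticTwist_mem_selmerLocalKer_iff`). -/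

/-- **`#E(ℚ_v)/2E(ℚ_v) ≥ 4 · #(𝓞_v/2𝓞_v)`** for a curve with rational `2`-torsion: `#E(ℚ_v)/2E(ℚ_v) = #E(ℚ_v)[2] · #(𝓞_v/2)`
(Milne I Lemma 3.3, tree `card_quotient_range_nsmul_adicCompletion`) and `#E(ℚ_v)[2] ≥ 4`.
[cite: MilneADT2006, I Lemma 3.3] [cite: SilvermanAEC2009, Prop. X.1.4] -/
theorem le_natCard_quotient_two_nsmul (h : E.toAffine.SplitTwoTorsion e₁ e₂ e₃) (v : HeightOneSpectrum (𝓞 ℚ))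
    [(E.baseChange (v.adicCompletion ℚ)).IsElliptic] :
    4 * Nat.card (v.adicCompletionIntegers ℚ ⧸ Ideal.span {(2 : v.adicCompletionIntegers ℚ)}) ≤
      Nat.card ((E.baseChange (v.adicCompletion ℚ)).toAffine.Point ⧸
        (nsmulAddMonoidHom 2 : (E.baseChange (v.adicCompletion ℚ)).toAffine.Point →+ _).range) := by
  have hF := h.map (v.adicCompletion ℚ)
  have hcz : CharZero (v.adicCompletion ℚ) ∧ True :=
    ⟨charZero_of_injective_algebraMap (algebraMap ℚ _).injective, trivial⟩
  have hq := E.card_quotient_range_nsmul_adicCompletion v (n := 2) two_ne_zero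
  haveI hfin := E.finite_ker_nsmul_adicCompletion v (n := 2) two_ne_zero
  have hequiv : (nsmulAddMonoidHom 2 : (E.baseChange (v.adicCompletion ℚ)).toAffine.Point →+ _).ker ≃
      AddSubgroup.torsionBy (E.baseChange (v.adicCompletion ℚ)).toAffine.Point ((2 : ℕ) : ℤ) :=
    Equiv.subtypeEquivRight fun x => by
      rw [AddMonoidHom.mem_ker, nsmulAddMonoidHom_apply, AddSubgroup.torsionBy.nsmul_iff]
  haveI : Finite (AddSubgroup.torsionBy (E.baseChange (v.adicCompletion ℚ)).toAffine.Point ((2 : ℕ) : ℤ)) :=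
    Finite.of_equiv _ hequiv
  have h4 : 4 ≤ Nat.card (nsmulAddMonoidHom 2 : (E.baseChange (v.adicCompletion ℚ)).toAffine.Point →+ _).ker := by
    rw [Nat.card_congr hequiv]
    exact @four_le_natCard_torsionBy_two_of_splitTwoTorsion _ _ hcz.1 _ _ _ _ _ _ hF _
  have h22 : ((2 : ℕ) : v.adicCompletionIntegers ℚ) = 2 := rfl
  rw [h22] at hq
  calc 4 * Nat.card (v.adicCompletionIntegers ℚ ⧸ Ideal.span {(2 : v.adicCompletionIntegers ℚ)})
      ≤ Nat.card (nsmulAddMonoidHom 2 : (E.baseChange (v.adicCompletion ℚ)).toAffine.Point →+ _).ker *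
          Nat.card (v.adicCompletionIntegers ℚ ⧸ Ideal.span {(2 : v.adicCompletionIntegers ℚ)}) :=
        Nat.mul_le_mul_right _ h4
    _ = _ := hq.symm

/-- `#(𝓞_v/2𝓞_v) ≥ 1`, and `≥ 2` at the dyadic place (`2` is not a unit of `𝓞_v` for `v ∣ 2`). [folklore] -/
theorem le_natCard_integers_quotient_two (v : HeightOneSpectrum (𝓞 ℚ)) :
    (if natGenerator v = 2 then 2 else 1) ≤
      Nat.card (v.adicCompletionIntegers ℚ ⧸ Ideal.span {(2 : v.adicCompletionIntegers ℚ)}) := by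
  haveI : Finite (v.adicCompletionIntegers ℚ ⧸ Ideal.span {(2 : v.adicCompletionIntegers ℚ)}) := by
    have := LocalPoints.card_quotient_span_natCast_ne_zero v (K := ℚ) two_ne_zero
    exact Nat.finite_of_card_ne_zero this
  by_cases h2 : natGenerator v = 2
  · rw [if_pos h2]
    -- `2 ∈ 𝔪_v`, so `𝓞_v/2` is nontrivial
    have hmem : ((2 : ℕ) : 𝓞 ℚ) ∈ v.asIdeal := by
      have := (RatPlace.intCast_mem_asIdeal_iff v 2).mpr (by rw [h2]; norm_num)
      exact_mod_cast this
    have hlt := LocalPoints.valuation_natCast_lt_one v (K := ℚ) hmem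
    have hnu : ¬ IsUnit ((2 : ℕ) : v.adicCompletionIntegers ℚ) := by
      rw [LocalPoints.isUnit_iff_valuation_eq_one]
      intro h1
      have : ((((2 : ℕ) : v.adicCompletionIntegers ℚ)) : v.adicCompletion ℚ) = (2 : ℕ) := rfl
      rw [this] at h1
      exact (ne_of_lt hlt) h1
    have hne : Ideal.span {(2 : v.adicCompletionIntegers ℚ)} ≠ ⊤ := by
      rw [Ne, Ideal.span_singleton_eq_top]
      exact_mod_cast hnu
    haveI : Nontrivial (v.adicCompletionIntegers ℚ ⧸ Ideal.span {(2 : v.adicCompletionIntegers ℚ)}) :=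
      Ideal.Quotient.nontrivial_iff.mpr hne
    exact Finite.one_lt_card
  · rw [if_neg h2]
    exact Nat.one_le_iff_ne_zero.mpr Nat.card_pos.ne'

/-- **The local Selmer condition at `v` has finite index `≤ #(ℚ_vˣ/ℚ_vˣ²)` in `H¹(ℚ, E[2])`** (rational `2`-torsion):
`selmerLocalKer E ℚ_v 2` contains the preimage, under localisation of the two components, of the descent image
`δ(E(ℚ_v)) ≤ (ℚ_vˣ/ℚ_vˣ²)²` (Silverman X.1.4 at the completion), whose index is
`#(ℚ_vˣ/ℚ_vˣ²)² / (#E(ℚ_v)[2] · #(𝓞_v/2)) ≤ 4` resp. `≤ 8` at `v = 2`.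
[cite: SilvermanAEC2009, Prop. X.1.4, Prop. X.4.9] [cite: MilneADT2006, I Lemma 3.3] -/
theorem index_selmerLocalKer_le (h : E.toAffine.SplitTwoTorsion e₁ e₂ e₃) (v : HeightOneSpectrum (𝓞 ℚ)) :
    (selmerLocalKer E (v.adicCompletion ℚ) 2).index ≠ 0 ∧
      (selmerLocalKer E (v.adicCompletion ℚ) 2).index ≤ (if natGenerator v = 2 then 8 else 4) := by
  set F := v.adicCompletion ℚ with hFdef
  haveI hEll : (E.baseChange F).IsElliptic := E.isElliptic_baseChange _
  have hF := h.map F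
  have hcz : CharZero F ∧ True := ⟨charZero_of_injective_algebraMap (algebraMap ℚ F).injective, trivial⟩
  haveI : NeZero ((2 : ℕ) : F) := ⟨by
    rw [show ((2 : ℕ) : F) = algebraMap ℚ F 2 by simp]
    exact (map_ne_zero _).mpr two_ne_zero⟩
  -- localisation of the two components (the `ℚ`-algebra structure of `F` is the completion one)
  let f₁ : galH1Torsion E 2 →+ Additive (SqUnits F) :=
    (kummerEquiv F 2).toAddMonoidHom.comp ((resMu ℚ F 2).comp (E.twoTorsionCharH1 h))
  let f₂ : galH1Torsion E 2 →+ Additive (SqUnits F) :=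
    (kummerEquiv F 2).toAddMonoidHom.comp ((resMu ℚ F 2).comp (E.twoTorsionCharH1 h.swap₁₂))
  let φ : galH1Torsion E 2 →+ Additive (SqUnits F × SqUnits F) :=
    { toFun := fun c => Additive.ofMul (Additive.toMul (f₁ c), Additive.toMul (f₂ c))
      map_zero' := by
        show Additive.ofMul (Additive.toMul (f₁ 0), Additive.toMul (f₂ 0)) = 0
        rw [f₁.map_zero, f₂.map_zero]; rfl
      map_add' := fun x y => by
        show Additive.ofMul (Additive.toMul (f₁ (x + y)), Additive.toMul (f₂ (x + y))) =
          Additive.ofMul (Additive.toMul (f₁ x), Additive.toMul (f₂ x)) +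
            Additive.ofMul (Additive.toMul (f₁ y), Additive.toMul (f₂ y))
        rw [f₁.map_add, f₂.map_add]; rfl }
  have hφ : ∀ (c : galH1Torsion E 2) (a b : ℚˣ),
      kummerEquiv ℚ 2 (E.twoTorsionCharH1 h c) = Additive.ofMul (QuotientGroup.mk a) →
      kummerEquiv ℚ 2 (E.twoTorsionCharH1 h.swap₁₂ c) = Additive.ofMul (QuotientGroup.mk b) →
      φ c = Additive.ofMul ((QuotientGroup.mk (Units.map (algebraMap ℚ F : ℚ →* F) a) : SqUnits F),
        (QuotientGroup.mk (Units.map (algebraMap ℚ F : ℚ →* F) b) : SqUnits F)) := by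
    intro c a b ha hb
    have hca : E.twoTorsionCharH1 h c = (kummerEquiv ℚ 2).symm (Additive.ofMul (QuotientGroup.mk a)) := by
      rw [← ha, AddEquiv.symm_apply_apply]
    have hcb : E.twoTorsionCharH1 h.swap₁₂ c = (kummerEquiv ℚ 2).symm (Additive.ofMul (QuotientGroup.mk b)) := by
      rw [← hb, AddEquiv.symm_apply_apply]
    show Additive.ofMul (Additive.toMul ((kummerEquiv F 2) ((resMu ℚ F 2) ((E.twoTorsionCharH1 h) c))),
      Additive.toMul ((kummerEquiv F 2) ((resMu ℚ F 2) ((E.twoTorsionCharH1 h.swap₁₂) c)))) = _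
    rw [hca, hcb, kummerEquiv_resMu_symm, kummerEquiv_resMu_symm]
    rfl
  -- the descent image `L = δ(E(ℚ_v))`, with the explicit `CharZero` instance
  set L : AddSubgroup (Additive (SqUnits F × SqUnits F)) := (@twoDescentMap _ _ _ _ _ _ _ hcz.1 _ hF).range with hL
  -- (i) the preimage of the descent image is contained in the local Selmer condition
  have hle : L.comap φ ≤ selmerLocalKer E F 2 := by
    intro c hc
    rw [AddSubgroup.mem_comap, hL, AddMonoidHom.mem_range] at hc
    obtain ⟨P, hP⟩ := hc
    obtain ⟨a, b, ha, hb⟩ := E.exists_kummerEquiv_twoTorsionCharH1_pair_eq h c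
    rw [hφ c a b ha hb, @twoDescentMap_apply _ _ _ _ _ _ _ hcz.1 _ hF] at hP
    have hP' := Additive.ofMul.injective hP
    rw [Prod.mk.injEq] at hP'
    exact @WeierstrassCurve.mem_selmerLocalKer_of_twoDescentComponent_eq _ _ _ E _ _ _ _ F _ _ hcz.1 h _ _ a b
      ha hb P hP'.1 hP'.2
  -- (ii) cardinalities: `#(SqUnits F)² = #L · [A : L]`, `#L ≥ N`
  have hN := natCard_sqUnits_adicCompletion_rat v
  have hA : Nat.card (Additive (SqUnits F × SqUnits F)) = Nat.card (SqUnits F) * Nat.card (SqUnits F) := by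
    rw [Nat.card_congr Additive.ofMul.symm, Nat.card_prod]
  have hmul := L.card_mul_index
  rw [hA] at hmul
  have hLge : 4 * Nat.card (v.adicCompletionIntegers ℚ ⧸ Ideal.span {(2 : v.adicCompletionIntegers ℚ)}) ≤ Nat.card L := by
    rw [hL, ← Nat.card_congr (QuotientAddGroup.quotientKerEquivRange (H := Additive (SqUnits F × SqUnits F))
      (@twoDescentMap _ _ _ _ _ _ _ hcz.1 _ hF)).toEquiv, @ker_twoDescentMap _ _ _ _ _ _ _ hcz.1 _ hF]
    exact le_natCard_quotient_two_nsmul E h v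
  have hOge := le_natCard_integers_quotient_two v
  -- `[A : L] ≠ 0` and `[A : L] ≤ 8 resp. 4`
  have hidx : L.index ≠ 0 ∧ L.index ≤ (if natGenerator v = 2 then 8 else 4) := by
    by_cases h2 : natGenerator v = 2
    · rw [if_pos h2] at hN hOge ⊢
      rw [hN] at hmul
      constructor
      · intro h0; rw [h0, mul_zero] at hmul; norm_num at hmul
      · nlinarith
    · rw [if_neg h2] at hN hOge ⊢
      rw [hN] at hmul
      constructor
      · intro h0; rw [h0, mul_zero] at hmul; norm_num at hmul
      · nlinarith
  -- (iii) `[G : comap φ L] ∣ [A : L]`, `[G : selmerLocalKer] ∣ [G : comap φ L]`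
  haveI : L.Normal := ⟨fun n hn g => by rw [add_comm g n, add_assoc, add_neg_cancel, add_zero]; exact hn⟩
  have hcomap : (L.comap φ).index ∣ L.index := by
    rw [AddSubgroup.index_comap]
    exact AddSubgroup.relIndex_dvd_index_of_normal _ _
  have hdvd : (selmerLocalKer E F 2).index ∣ (L.comap φ).index := AddSubgroup.index_dvd_of_le hle
  have hd := hdvd.trans hcomap
  exact ⟨fun h0 => hidx.1 (Nat.eq_zero_of_zero_dvd (h0 ▸ hd)), (Nat.le_of_dvd (Nat.pos_of_ne_zero hidx.1) hd).trans hidx.2⟩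

end LocalIndex

end Summit.BirchSwinnertonDyer.BirchSwinnertonDyer.Theorems.GenusKolyvaginAtTwo.TorsionCellD0

end
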